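import Summits.ValiantsHypothesis.ValiantsHypothesis.Theorems.FeketeSOSFeketeSOSHardPaleyRIPFlatRIPPolarisation
import Mathlib.Analysis.SpecialFunctions.Pow.Real
import Mathlib.Data.Nat.Prime.Infinite

/-!
# Route FeketeSOS — crux `FeketeSOSHard` (stmt-ValiantsHypothesis-3996), line `paley-rip`,
# stub `stub_paleyFlatRIP`: the NORM FLOOR of sparse Paley–Hankel blocks and the exponent region
# `κ + δ₁/2 ≤ 1/4` of the engine

The engine `stub_paleyFlatRIP` of the line of record `Cruxes/FeketeSOSHard/Lines/paley_rip_v3.lean` asks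
for exponents `κ, δ₁ > 0` with `|Q_p(S,w)| ≤ p^{1/2−κ} Σ_{a∈S}|w_a|²` for all large primes `p`, all
`S ⊆ [0,p)` with `#S ≤ p^{1/2+δ₁}` and all complex weights `w` (`Q_p(S,w) = Σ_{a,b∈S} χ_p(a+b) w_a w_b`):
PaleyRIP beyond the square-root bottleneck (Bandeira–Fickus–Mixon–Wong 2013 §6; Bandeira–Mixon–Moreira
2017 §2; listed open as Conjecture 14 of Bandeira's *Open problems of 2025*, arXiv:2603.29571), an
OPEN PROBLEM which implies `ω(Paley_p) ≤ p^{1/2−κ}+1` (`…FlatRIPPaleyClique.lean`).  The earlier files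
of this seat pinned WHAT the engine is (⟺ flat Paley discrepancy beyond `√p`) and that `δ₁ < 1/2` is
forced (`…CompletionSharp.lean`).  This file adds the quantitative LOWER side of the picture, sorry-free
and elementary (no spectral theorem, no Gauss sums):

* `card_sub_one_le_rowEnergy` — every row of a principal block `H_S = (χ_p(a+b))_{a,b∈S}`, `S ⊆ [0,p)`,
  has `Σ_{b∈S} χ_p(a+b)² ≥ #S − 1` (the block is a `±1` matrix off at most one entry per row);
* `exists_paleyForm_ge_sqrt_card` — **NORM FLOOR**: for every `S ⊆ [0,p)` with `#S ≥ 2` there are weights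
  `w ≢ 0` on `S` with `|Q_p(S,w)| ≥ (√(#S−1)/2)·Σ|w_a|²`, i.e. `‖H_S‖ ≥ √(#S−1)/2`.  Proof by POLARISATION
  (`paleyForm_add_sub_paleyForm_sub`, `…FlatRIPPolarisation.lean`): with `u` the `a`-th row and the spike
  `√N'·e_a` (`N' = ‖u‖²`), `Q(√N' e_a + u) − Q(√N' e_a − u) = 4N'^{3/2}` while the two test vectors have
  total mass `4N'`, so one of them has Rayleigh quotient `≥ √N'/2 ≥ √(#S−1)/2`;
* `sqrt_le_rpow_of_flatRIPAt` / `sub_one_le_rpow_of_flatRIPAt` — at one prime, the engine's inequality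
  with exponents `(κ, δ₁)` forces `√(n−1)/2 ≤ p^{1/2−κ}`, i.e. `n − 1 ≤ 4p^{1−2κ}`, for every block size
  `2 ≤ n ≤ min(p, p^{1/2+δ₁})`;
* `kappa_add_half_delta_le_quarter_of_flatRIP` / `flatRIP_exponent_region` — **EXPONENT REGION**: if the
  engine's inequality holds with `(κ, δ₁)`, `κ, δ₁ > 0`, at all large primes, then `κ + δ₁/2 ≤ 1/4`; so
  every witnessing pair of the registered `∃`-statement lies in `0 < κ < 1/4`, `0 < δ₁ ≤ 1/2 − 2κ < 1/2`
  (sharpening `delta_lt_half_of_flatRIPAt`).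

Reading.  In RIP language this is the trivial floor `δ_K ≳ √(K/p)` for the order-`K` restricted-isometry
constant of the `p`-column Paley–Hankel system; for a RANDOM symmetric `±1` block the norm is `≍ 2√#S`,
so the floor is the conjectured truth and the engine is EXPECTED to hold for every `κ < 1/4 − δ₁/2`
("Paley blocks are as flat as random blocks") — while NO pair `κ, δ₁ > 0` is known (square-root
barrier for character sums over unstructured sets; Hanson–Petridis `ω(Paley_p) ≤ √(p/2)+1` is the
state of the art on the clique side).  The Fekete composition `FeketeSOSHard_of` needs just one pair.

Honest framing: necessary conditions on the exponents of an OPEN statement, landed `--supports` the crux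
item; the crux `FeketeSOSHard`, the engine and `stub_tameOperator` remain open; nothing here bears on
`VP ≠ VNP`.
-/

-- the line's namespace repeats a path segment by convention (same as the other paley-rip files)
set_option linter.dupNamespace false

namespace Summit.ValiantsHypothesis.ValiantsHypothesis.Theorems.FeketeSOSHardPaleyRIP

open Finset
open scoped BigOperators

noncomputable section

section NormFloor

variable (p : ℕ) [Fact p.Prime]

/-- The Paley–Hankel form of REAL weights is the real double sum `Σ_{a,b∈S} χ_p(a+b) r_a r_b`
(cast to `ℂ`). [folklore] -/
theorem paleyForm_ofReal (S : Finset ℕ) (r : ℕ → ℝ) :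
    paleyForm p S (fun a => ((r a : ℝ) : ℂ)) =
      ((∑ a ∈ S, ∑ b ∈ S, ((legendreSym p ((a : ℤ) + b) : ℤ) : ℝ) * r a * r b : ℝ) : ℂ) := by
  unfold paleyForm
  push_cast
  rfl

/-- The norm of the Paley–Hankel form of real weights is the absolute value of the real double sum.
[folklore] -/
theorem norm_paleyForm_ofReal (S : Finset ℕ) (r : ℕ → ℝ) :
    ‖paleyForm p S (fun a => ((r a : ℝ) : ℂ))‖ =
      |∑ a ∈ S, ∑ b ∈ S, ((legendreSym p ((a : ℤ) + b) : ℤ) : ℝ) * r a * r b| := by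
  rw [paleyForm_ofReal, Complex.norm_real, Real.norm_eq_abs]

/-- The squared real Legendre symbol is `0` or `1`: it is `1` unless the symbol vanishes. [folklore] -/
theorem legendreSym_cast_sq_eq_ite (x : ℤ) :
    (((legendreSym p x : ℤ) : ℝ)) ^ 2 = if legendreSym p x = 0 then 0 else 1 := by
  rcases quadraticChar_isQuadratic (ZMod p) (x : ZMod p) with h | h | h
  · have h' : legendreSym p x = 0 := h
    rw [if_pos h', h']; simp
  · have h' : legendreSym p x = 1 := h
    rw [if_neg (by rw [h']; norm_num), h']; simp
  · have h' : legendreSym p x = -1 := h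
    rw [if_neg (by rw [h']; norm_num), h']; simp

/-- In a row of a Paley–Hankel block on `S ⊆ [0,p)` at most ONE entry vanishes: `χ_p(a+b) = 0` forces
`b ≡ −a (mod p)`, and `S` has at most one representative of each residue. [folklore] -/
theorem card_filter_legendreSym_add_eq_zero_le_one (S : Finset ℕ) (hS : ∀ b ∈ S, b < p) (a : ℕ) :
    (S.filter (fun b : ℕ => legendreSym p ((a : ℤ) + (b : ℤ)) = 0)).card ≤ 1 := by
  rw [Finset.card_le_one]
  intro b hb c hc
  rw [Finset.mem_filter] at hb hc
  have hb0 := (legendreSym.eq_zero_iff p _).1 hb.2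
  have hc0 := (legendreSym.eq_zero_iff p _).1 hc.2
  push_cast at hb0 hc0
  have hbc : ((b : ℕ) : ZMod p) = ((c : ℕ) : ZMod p) := by
    have e1 : ((b : ℕ) : ZMod p) = -((a : ℕ) : ZMod p) := eq_neg_of_add_eq_zero_right hb0
    have e2 : ((c : ℕ) : ZMod p) = -((a : ℕ) : ZMod p) := eq_neg_of_add_eq_zero_right hc0
    rw [e1, e2]
  have hbv : ((b : ℕ) : ZMod p).val = b := ZMod.val_cast_of_lt (hS b hb.1)
  have hcv : ((c : ℕ) : ZMod p).val = c := ZMod.val_cast_of_lt (hS c hc.1)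
  rw [← hbv, ← hcv, hbc]

/-- **Row energy.** For `S ⊆ [0,p)` and any `a`: `Σ_{b∈S} χ_p(a+b)² ≥ #S − 1` (all entries of the row are
`±1` except at most one). [folklore] -/
theorem card_sub_one_le_rowEnergy (S : Finset ℕ) (hS : ∀ b ∈ S, b < p) (a : ℕ) :
    (S.card : ℝ) - 1 ≤ ∑ b ∈ S, (((legendreSym p ((a : ℤ) + b) : ℤ) : ℝ)) ^ 2 := by
  classical
  have hsum : ∑ b ∈ S, (((legendreSym p ((a : ℤ) + b) : ℤ) : ℝ)) ^ 2 =
      ∑ b ∈ S, (if legendreSym p ((a : ℤ) + b) = 0 then (0 : ℝ) else 1) :=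
    sum_congr rfl fun b _ => legendreSym_cast_sq_eq_ite p _
  have hsplit : ∑ b ∈ S, (if legendreSym p ((a : ℤ) + b) = 0 then (0 : ℝ) else 1) =
      (S.card : ℝ) - ∑ b ∈ S, (if legendreSym p ((a : ℤ) + b) = 0 then (1 : ℝ) else 0) := by
    rw [eq_sub_iff_add_eq, ← sum_add_distrib]
    have : ∀ b ∈ S, ((if legendreSym p ((a : ℤ) + b) = 0 then (0 : ℝ) else 1) +
        (if legendreSym p ((a : ℤ) + b) = 0 then (1 : ℝ) else 0)) = 1 := by
      intro b _; split_ifs <;> norm_num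
    rw [sum_congr rfl this]; simp
  rw [hsum, hsplit, sum_boole]
  have h1 : ((S.filter (fun b : ℕ => legendreSym p ((a : ℤ) + (b : ℤ)) = 0)).card : ℝ) ≤ 1 := by
    exact_mod_cast card_filter_legendreSym_add_eq_zero_le_one p S hS a
  linarith

/-- The row `b ↦ χ_p(a+b)` of the Paley–Hankel kernel, as complex weights, has `Σ_{b∈S} |χ_p(a+b)|²`
equal to the real row energy `Σ_{b∈S} χ_p(a+b)²`. [folklore] -/
theorem sum_norm_sq_row (S : Finset ℕ) (a : ℕ) :
    ∑ b ∈ S, ‖(((legendreSym p ((a : ℤ) + b) : ℤ) : ℂ))‖ ^ 2 =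
      ∑ b ∈ S, (((legendreSym p ((a : ℤ) + b) : ℤ) : ℝ)) ^ 2 := by
  refine sum_congr rfl fun b _ => ?_
  rw [← Complex.ofReal_intCast, Complex.norm_real, Real.norm_eq_abs, sq_abs]

/-- Pairing the row `χ_p(a+·)` against itself through the kernel's `a`-th row: `Σ_{c∈S} χ_p(a+c)·χ_p(a+c)`
is the row energy (as a complex number). [folklore] -/
theorem sum_row_mul_row (S : Finset ℕ) (a : ℕ) :
    ∑ c ∈ S, ((legendreSym p ((a : ℤ) + c) : ℤ) : ℂ) * ((legendreSym p ((a : ℤ) + c) : ℤ) : ℂ) =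
      ((∑ c ∈ S, (((legendreSym p ((a : ℤ) + c) : ℤ) : ℝ)) ^ 2 : ℝ) : ℂ) := by
  push_cast
  refine sum_congr rfl fun c _ => ?_
  ring

/-- The bilinear Paley–Hankel sum of a spike `s·e_a` (`a ∈ S`) against weights `v` is `s` times the
`a`-th row applied to `v`: `Σ_{b,c∈S} χ_p(b+c) (s·[b=a]) v_c = s · Σ_{c∈S} χ_p(a+c) v_c`. [folklore] -/
theorem paleyBilin_spike_left (S : Finset ℕ) (a : ℕ) (ha : a ∈ S) (s : ℂ) (v : ℕ → ℂ) :
    ∑ b ∈ S, ∑ c ∈ S, ((legendreSym p ((b : ℤ) + c) : ℤ) : ℂ) * (s * (if b = a then 1 else 0)) * v c =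
      s * ∑ c ∈ S, ((legendreSym p ((a : ℤ) + c) : ℤ) : ℂ) * v c := by
  classical
  have hterm : ∀ b ∈ S, ∑ c ∈ S, ((legendreSym p ((b : ℤ) + c) : ℤ) : ℂ) * (s * (if b = a then 1 else 0)) * v c =
      if b = a then s * ∑ c ∈ S, ((legendreSym p ((a : ℤ) + c) : ℤ) : ℂ) * v c else 0 := by
    intro b _
    split_ifs with hb
    · subst hb
      rw [mul_sum]
      refine sum_congr rfl fun c _ => ?_
      ring
    · simp
  rw [sum_congr rfl hterm, sum_ite_eq' S a, if_pos ha]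

/-- The spike `s·e_a` has `Σ_{b∈S} |s·[b=a]|² = |s|²` (`a ∈ S`). [folklore] -/
theorem sum_norm_sq_spike (S : Finset ℕ) (a : ℕ) (ha : a ∈ S) (s : ℂ) :
    ∑ b ∈ S, ‖s * (if b = a then (1 : ℂ) else 0)‖ ^ 2 = ‖s‖ ^ 2 := by
  classical
  have hterm : ∀ b ∈ S, ‖s * (if b = a then (1 : ℂ) else 0)‖ ^ 2 = if b = a then ‖s‖ ^ 2 else 0 := by
    intro b _
    split_ifs <;> simp
  rw [sum_congr rfl hterm, sum_ite_eq' S a, if_pos ha]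

/-- Weights vanishing on `S` (zero `ℓ²`-mass on `S`) have zero Paley–Hankel form. [folklore] -/
theorem paleyForm_eq_zero_of_sum_norm_sq_eq_zero (S : Finset ℕ) (w : ℕ → ℂ)
    (hw : ∑ a ∈ S, ‖w a‖ ^ 2 = 0) : paleyForm p S w = 0 := by
  have hzero : ∀ a ∈ S, w a = 0 := by
    intro a ha
    have h := (sum_eq_zero_iff_of_nonneg (fun b _ => sq_nonneg (‖w b‖))).1 hw a ha
    rwa [sq_eq_zero_iff, norm_eq_zero] at h
  unfold paleyForm
  refine sum_eq_zero fun a ha => sum_eq_zero fun b _ => ?_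
  rw [hzero a ha]; ring

/-- **NORM FLOOR of sparse Paley–Hankel blocks (elementary, no spectral theorem).**  For every prime `p`
and every `S ⊆ [0,p)` with `#S ≥ 2` there are complex (indeed real) weights `w` on `S`, not all zero,
with `|Q_p(S,w)| ≥ (√(#S − 1)/2) · Σ_{a∈S}|w_a|²`.  In operator language: every principal `S × S` block
`H_S = (χ_p(a+b))_{a,b∈S}` of the Paley–Hankel matrix has `‖H_S‖ ≥ √(#S−1)/2` — the block is a `±1`
matrix off at most one entry per row, so `‖H_S‖_F² ≥ #S(#S−1)`, and the proof realises the Frobenius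
floor by POLARISATION: with `u = χ_p(a+·)` the `a`-th row (`‖u‖² = N' ≥ #S−1`) and the spike `√N'·e_a`,
`Q(√N' e_a + u) − Q(√N' e_a − u) = 4√N'·Σ_c χ_p(a+c)² = 4 N'^{3/2}` while
`‖√N' e_a + u‖² + ‖√N' e_a − u‖² = 4N'`, so one of the two test vectors has Rayleigh quotient `≥ √N'/2`.
Consequence (below): the engine `stub_paleyFlatRIP` can only hold with `p^{1/2−κ} ≥ √(#S−1)/2` at
`#S = p^{1/2+δ₁}`, i.e. `κ + δ₁/2 ≤ 1/4`.  (For a RANDOM symmetric `±1` matrix the norm IS `≍ √#S`, so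
this floor is the conjectured truth for Paley blocks: the engine is expected to hold for every
`κ < 1/4 − δ₁/2` and is known for none.) [folklore] -/
theorem exists_paleyForm_ge_sqrt_card (S : Finset ℕ) (hS : ∀ b ∈ S, b < p) (h2 : 2 ≤ S.card) :
    ∃ w : ℕ → ℂ, 0 < ∑ a ∈ S, ‖w a‖ ^ 2 ∧
      Real.sqrt ((S.card : ℝ) - 1) / 2 * ∑ a ∈ S, ‖w a‖ ^ 2 ≤ ‖paleyForm p S w‖ := by
  classical
  obtain ⟨a, ha⟩ : S.Nonempty := card_pos.1 (by omega)
  -- the `a`-th row `u`, its energy `N'`, and the spike `U = √N' · e_a`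
  set u : ℕ → ℂ := fun b => ((legendreSym p ((a : ℤ) + b) : ℤ) : ℂ) with hu
  set N' : ℝ := ∑ b ∈ S, (((legendreSym p ((a : ℤ) + b) : ℤ) : ℝ)) ^ 2 with hN'
  have hN'ge : (S.card : ℝ) - 1 ≤ N' := card_sub_one_le_rowEnergy p S hS a
  have h2' : (2 : ℝ) ≤ S.card := by exact_mod_cast h2
  have hN'pos : 0 < N' := by linarith
  set s : ℝ := Real.sqrt N' with hs
  have hs0 : 0 < s := Real.sqrt_pos.2 hN'pos
  have hs2 : s ^ 2 = N' := Real.sq_sqrt hN'pos.le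
  have hsqrt_le : Real.sqrt ((S.card : ℝ) - 1) ≤ s := Real.sqrt_le_sqrt hN'ge
  set U : ℕ → ℂ := fun b => (s : ℂ) * (if b = a then 1 else 0) with hU
  -- norms
  have hnu : ∑ b ∈ S, ‖u b‖ ^ 2 = N' := sum_norm_sq_row p S a
  have hnU : ∑ b ∈ S, ‖U b‖ ^ 2 = N' := by
    rw [hU, sum_norm_sq_spike S a ha, Complex.norm_real, Real.norm_eq_abs, sq_abs, hs2]
  have hpar := sum_norm_sq_add_add_sum_norm_sq_sub S U u
  rw [hnU, hnu] at hpar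
  -- polarisation: Q(U+u) − Q(U−u) = 4 s N'
  have hbil : ∑ b ∈ S, ∑ c ∈ S, ((legendreSym p ((b : ℤ) + c) : ℤ) : ℂ) * U b * u c =
      ((s * N' : ℝ) : ℂ) := by
    rw [hU, paleyBilin_spike_left p S a ha, hu, sum_row_mul_row p S a, hN']
    push_cast; ring
  have hpol := paleyForm_add_sub_paleyForm_sub p S U u
  rw [hbil] at hpol
  have hdiff : ‖paleyForm p S (fun b => U b + u b) - paleyForm p S (fun b => U b - u b)‖ = 4 * (s * N') := by
    rw [hpol, norm_mul, Complex.norm_real, Real.norm_eq_abs, abs_of_pos (mul_pos hs0 hN'pos)]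
    norm_num
  have htri : 4 * (s * N') ≤ ‖paleyForm p S (fun b => U b + u b)‖ + ‖paleyForm p S (fun b => U b - u b)‖ := by
    rw [← hdiff]; exact norm_sub_le _ _
  -- one of the two test vectors wins
  have key : ∀ w : ℕ → ℂ, 2 * (s * N') ≤ ‖paleyForm p S w‖ → ∑ b ∈ S, ‖w b‖ ^ 2 ≤ 4 * N' →
      (0 < ∑ b ∈ S, ‖w b‖ ^ 2 ∧
        Real.sqrt ((S.card : ℝ) - 1) / 2 * ∑ b ∈ S, ‖w b‖ ^ 2 ≤ ‖paleyForm p S w‖) := by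
    intro w hQ hW
    have hWnn : 0 ≤ ∑ b ∈ S, ‖w b‖ ^ 2 := sum_nonneg fun b _ => sq_nonneg _
    refine ⟨?_, ?_⟩
    · rcases hWnn.lt_or_eq with hlt | heq
      · exact hlt
      · exfalso
        have h0 := paleyForm_eq_zero_of_sum_norm_sq_eq_zero p S w heq.symm
        rw [h0, norm_zero] at hQ
        nlinarith [mul_pos hs0 hN'pos]
    · calc Real.sqrt ((S.card : ℝ) - 1) / 2 * ∑ b ∈ S, ‖w b‖ ^ 2
          ≤ s / 2 * (4 * N') := by
            apply mul_le_mul _ hW hWnn (by linarith)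
            linarith
        _ = 2 * (s * N') := by ring
        _ ≤ ‖paleyForm p S w‖ := hQ
  have hnn1 : 0 ≤ ∑ b ∈ S, ‖U b + u b‖ ^ 2 := sum_nonneg fun b _ => sq_nonneg _
  have hnn2 : 0 ≤ ∑ b ∈ S, ‖U b - u b‖ ^ 2 := sum_nonneg fun b _ => sq_nonneg _
  by_cases hplus : 2 * (s * N') ≤ ‖paleyForm p S (fun b => U b + u b)‖
  · exact ⟨fun b => U b + u b, key _ hplus (by linarith)⟩
  · push Not at hplus
    exact ⟨fun b => U b - u b, key _ (by linarith) (by linarith)⟩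

/-! ## Consequence for the engine's exponents: `κ + δ₁/2 ≤ 1/4` -/

/-- **The floor against the engine, at one prime.**  If the inequality of `stub_paleyFlatRIP` holds at
`p` with exponents `(κ, δ₁)`, then for every `n` with `2 ≤ n ≤ p` and `n ≤ p^{1/2+δ₁}` (test the block
`S = [0,n)`): `√(n−1)/2 ≤ p^{1/2−κ}`. [folklore] -/
theorem sqrt_le_rpow_of_flatRIPAt (κ δ₁ : ℝ)
    (hB : ∀ (S : Finset ℕ), (∀ a ∈ S, a < p) → (S.card : ℝ) ≤ (p : ℝ) ^ (1 / 2 + δ₁) →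
      ∀ (w : ℕ → ℂ), ‖paleyForm p S w‖ ≤ (p : ℝ) ^ (1 / 2 - κ) * ∑ a ∈ S, ‖w a‖ ^ 2)
    (n : ℕ) (hn2 : 2 ≤ n) (hnp : n ≤ p) (hnK : (n : ℝ) ≤ (p : ℝ) ^ (1 / 2 + δ₁)) :
    Real.sqrt ((n : ℝ) - 1) / 2 ≤ (p : ℝ) ^ (1 / 2 - κ) := by
  have hS : ∀ a ∈ range n, a < p := fun a ha => lt_of_lt_of_le (mem_range.1 ha) hnp
  obtain ⟨w, hwpos, hw⟩ :=
    exists_paleyForm_ge_sqrt_card p (range n) hS (by rw [card_range]; exact hn2)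
  rw [card_range] at hw
  have hup := hB (range n) hS (by rw [card_range]; exact hnK) w
  exact le_of_mul_le_mul_right (hw.trans hup) hwpos

/-- Squared form of the floor: under the engine's inequality at `p` with exponents `(κ, δ₁)`,
`n − 1 ≤ 4·p^{1−2κ}` for every `2 ≤ n ≤ min(p, p^{1/2+δ₁})`. [folklore] -/
theorem sub_one_le_rpow_of_flatRIPAt (κ δ₁ : ℝ)
    (hB : ∀ (S : Finset ℕ), (∀ a ∈ S, a < p) → (S.card : ℝ) ≤ (p : ℝ) ^ (1 / 2 + δ₁) →
      ∀ (w : ℕ → ℂ), ‖paleyForm p S w‖ ≤ (p : ℝ) ^ (1 / 2 - κ) * ∑ a ∈ S, ‖w a‖ ^ 2)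
    (n : ℕ) (hn2 : 2 ≤ n) (hnp : n ≤ p) (hnK : (n : ℝ) ≤ (p : ℝ) ^ (1 / 2 + δ₁)) :
    (n : ℝ) - 1 ≤ 4 * (p : ℝ) ^ (1 - 2 * κ) := by
  have hp0 : (0 : ℝ) ≤ (p : ℝ) := Nat.cast_nonneg _
  have h := sqrt_le_rpow_of_flatRIPAt p κ δ₁ hB n hn2 hnp hnK
  have h' : Real.sqrt ((n : ℝ) - 1) ≤ 2 * (p : ℝ) ^ (1 / 2 - κ) := by linarith
  have hnn : 0 ≤ 2 * (p : ℝ) ^ (1 / 2 - κ) := by positivity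
  rw [Real.sqrt_le_left hnn] at h'
  have hsq : (2 * (p : ℝ) ^ (1 / 2 - κ)) ^ 2 = 4 * (p : ℝ) ^ (1 - 2 * κ) := by
    rw [mul_pow, ← Real.rpow_natCast ((p : ℝ) ^ (1 / 2 - κ)) 2, ← Real.rpow_mul hp0]
    norm_num
    ring_nf
  rwa [hsq] at h'

/-- **Exponent region of the engine.**  If the inequality of `stub_paleyFlatRIP` holds with exponents
`(κ, δ₁)`, `κ, δ₁ > 0`, at all sufficiently large primes, then `κ + δ₁/2 ≤ 1/4` (equivalently
`δ₁ ≤ 1/2 − 2κ`, in particular `κ < 1/4` and `δ₁ < 1/2`).  Proof: at a large prime test the block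
`[0,n)` with `n = min(p, ⌊p^{1/2+δ₁}⌋)`: the norm floor gives `n − 1 ≤ 4p^{1−2κ}`, i.e. `p^{2κ} ≤ 8` or
`p^{2κ+δ₁−1/2} ≤ 8`, false for large `p` when `2κ + δ₁ > 1/2`.  This is the random-matrix floor
`‖H_S‖ ≳ √#S` written in the engine's exponents; conjecturally it is sharp (Paley blocks are expected
to be as flat as random `±1` blocks), and NO pair `(κ, δ₁)` with `κ, δ₁ > 0` is known to be admissible
(that is the open problem PaleyRIP beyond `√p`). [folklore] -/
theorem kappa_add_half_delta_le_quarter_of_flatRIP (κ δ₁ : ℝ) (hκ : 0 < κ) (hδ₁ : 0 < δ₁) (p₁ : ℕ)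
    (hB : ∀ (p : ℕ) [Fact p.Prime], p₁ ≤ p →
      ∀ (S : Finset ℕ), (∀ a ∈ S, a < p) → (S.card : ℝ) ≤ (p : ℝ) ^ (1 / 2 + δ₁) →
      ∀ (w : ℕ → ℂ), ‖paleyForm p S w‖ ≤ (p : ℝ) ^ (1 / 2 - κ) * ∑ a ∈ S, ‖w a‖ ^ 2) :
    κ + δ₁ / 2 ≤ 1 / 4 := by
  by_contra hlt
  push Not at hlt
  -- the two positive exponents that must be beaten
  set θ : ℝ := 2 * κ + δ₁ - 1 / 2 with hθ
  have hθ0 : 0 < θ := by rw [hθ]; linarith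
  have h2κ : 0 < 2 * κ := by linarith
  -- thresholds: `9 ≤ p^{2κ}`, `9 ≤ p^θ`, `16 ≤ p`
  obtain ⟨N₁, hN₁⟩ : ∃ N : ℕ, (9 : ℝ) ^ (1 / (2 * κ)) ≤ (N : ℝ) := ⟨_, Nat.le_ceil _⟩
  obtain ⟨N₂, hN₂⟩ : ∃ N : ℕ, (9 : ℝ) ^ (1 / θ) ≤ (N : ℝ) := ⟨_, Nat.le_ceil _⟩
  obtain ⟨q, hq, hqprime⟩ := Nat.exists_infinite_primes (max p₁ (max N₁ (max N₂ 16)))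
  haveI : Fact q.Prime := ⟨hqprime⟩
  have hqp₁ : p₁ ≤ q := le_trans (le_max_left _ _) hq
  have hqN₁ : (N₁ : ℝ) ≤ q := by exact_mod_cast le_trans (le_trans (le_max_left _ _) (le_max_right _ _)) hq
  have hqN₂ : (N₂ : ℝ) ≤ q := by
    exact_mod_cast le_trans (le_trans (le_trans (le_max_left _ _) (le_max_right _ _)) (le_max_right _ _)) hq
  have hq16 : (16 : ℝ) ≤ q := by
    exact_mod_cast le_trans (le_trans (le_trans (le_max_right _ _) (le_max_right _ _)) (le_max_right _ _)) hq
  have hq0 : (0 : ℝ) < q := by linarith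
  have hq1 : (1 : ℝ) ≤ q := by linarith
  have h9a : (9 : ℝ) ≤ (q : ℝ) ^ (2 * κ) := by
    have h0 : (0 : ℝ) ≤ (9 : ℝ) ^ (1 / (2 * κ)) := Real.rpow_nonneg (by norm_num) _
    calc (9 : ℝ) = ((9 : ℝ) ^ (1 / (2 * κ))) ^ (2 * κ) := by
          rw [one_div, Real.rpow_inv_rpow (by norm_num) h2κ.ne']
      _ ≤ (q : ℝ) ^ (2 * κ) := Real.rpow_le_rpow h0 (hN₁.trans hqN₁) h2κ.le
  have h9b : (9 : ℝ) ≤ (q : ℝ) ^ θ := by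
    have h0 : (0 : ℝ) ≤ (9 : ℝ) ^ (1 / θ) := Real.rpow_nonneg (by norm_num) _
    calc (9 : ℝ) = ((9 : ℝ) ^ (1 / θ)) ^ θ := by
          rw [one_div, Real.rpow_inv_rpow (by norm_num) hθ0.ne']
      _ ≤ (q : ℝ) ^ θ := Real.rpow_le_rpow h0 (hN₂.trans hqN₂) hθ0.le
  have hBq := hB q hqp₁
  set K : ℝ := (q : ℝ) ^ (1 / 2 + δ₁) with hK
  have hK4 : (4 : ℝ) ≤ K := by
    have h16 : Real.sqrt 16 = 4 := by
      rw [show (16 : ℝ) = 4 ^ 2 by norm_num, Real.sqrt_sq (by norm_num)]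
    calc (4 : ℝ) = Real.sqrt 16 := h16.symm
      _ ≤ Real.sqrt q := Real.sqrt_le_sqrt hq16
      _ = (q : ℝ) ^ (1 / 2 : ℝ) := Real.sqrt_eq_rpow _
      _ ≤ K := Real.rpow_le_rpow_of_exponent_le hq1 (by linarith)
  by_cases hKq : (q : ℝ) ≤ K
  · -- the full block `[0,q)` is admissible: `q − 1 ≤ 4 q^{1−2κ}`, against `q^{2κ} ≥ 9`
    have h := sub_one_le_rpow_of_flatRIPAt q κ δ₁ hBq q (by exact_mod_cast (show (2:ℝ) ≤ q by linarith))
      le_rfl hKq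
    have hsplit : (q : ℝ) = (q : ℝ) ^ (1 - 2 * κ) * (q : ℝ) ^ (2 * κ) := by
      rw [← Real.rpow_add hq0]; ring_nf; exact (Real.rpow_one _).symm
    have hpos : 0 < (q : ℝ) ^ (1 - 2 * κ) := Real.rpow_pos_of_pos hq0 _
    -- q − 1 ≥ q/2 ≥ (9/2) q^{1−2κ} > 4 q^{1−2κ}
    have : (q : ℝ) ^ (1 - 2 * κ) * 9 ≤ (q : ℝ) :=
      calc (q : ℝ) ^ (1 - 2 * κ) * 9 ≤ (q : ℝ) ^ (1 - 2 * κ) * (q : ℝ) ^ (2 * κ) :=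
            mul_le_mul_of_nonneg_left h9a hpos.le
        _ = (q : ℝ) := hsplit.symm
    nlinarith
  · -- the block `[0, ⌊K⌋)`: `⌊K⌋ − 1 ≤ 4 q^{1−2κ}`, against `q^θ ≥ 9`
    push Not at hKq
    set n : ℕ := ⌊K⌋₊ with hn
    have hKnn : 0 ≤ K := by linarith
    have hnle : (n : ℝ) ≤ K := Nat.floor_le hKnn
    have hnlt : K < (n : ℝ) + 1 := Nat.lt_floor_add_one _
    have hn2 : 2 ≤ n := by
      have : (2 : ℝ) < (n : ℝ) + 1 - 1 := by linarith
      have : (2 : ℝ) < n := by linarith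
      exact_mod_cast this.le
    have hnq : n ≤ q := by exact_mod_cast (hnle.trans hKq.le)
    have h := sub_one_le_rpow_of_flatRIPAt q κ δ₁ hBq n hn2 hnq hnle
    -- K − 2 ≤ n − 1 ≤ 4 q^{1−2κ}, and K = q^{1−2κ} q^θ ≥ 9 q^{1−2κ}
    have hsplit : K = (q : ℝ) ^ (1 - 2 * κ) * (q : ℝ) ^ θ := by
      rw [hK, ← Real.rpow_add hq0, hθ]; ring_nf
    have hpos : 0 < (q : ℝ) ^ (1 - 2 * κ) := Real.rpow_pos_of_pos hq0 _
    have hK9 : (q : ℝ) ^ (1 - 2 * κ) * 9 ≤ K := by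
      rw [hsplit]; exact mul_le_mul_of_nonneg_left h9b hpos.le
    nlinarith

/-- The same region read off the REGISTERED `∃`-statement of `stub_paleyFlatRIP`: any witnessing pair
`(κ, δ₁)` of the engine satisfies `κ + δ₁/2 ≤ 1/4`; together with `κ, δ₁ > 0` the admissible region is
contained in the open triangle `0 < κ < 1/4`, `0 < δ₁ < 1/2 − 2κ`.  (Recovers and sharpens
`delta_lt_half_of_flatRIPAt` of `…PaleyRIPCompletionSharp.lean`.) [folklore] -/
theorem flatRIP_exponent_region
    (κ δ₁ : ℝ) (hκ : 0 < κ) (hδ₁ : 0 < δ₁)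
    (hB : ∃ p₁ : ℕ, ∀ (p : ℕ) [Fact p.Prime], p₁ ≤ p →
      ∀ (S : Finset ℕ), (∀ a ∈ S, a < p) → (S.card : ℝ) ≤ (p : ℝ) ^ (1 / 2 + δ₁) →
      ∀ (w : ℕ → ℂ), ‖paleyForm p S w‖ ≤ (p : ℝ) ^ (1 / 2 - κ) * ∑ a ∈ S, ‖w a‖ ^ 2) :
    κ < 1 / 4 ∧ δ₁ < 1 / 2 ∧ κ + δ₁ / 2 ≤ 1 / 4 := by
  obtain ⟨p₁, hB⟩ := hB
  have h := kappa_add_half_delta_le_quarter_of_flatRIP κ δ₁ hκ hδ₁ p₁ hB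
  exact ⟨by linarith, by linarith, h⟩

end NormFloor

end

end Summit.ValiantsHypothesis.ValiantsHypothesis.Theorems.FeketeSOSHardPaleyRIP
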